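import Mathlib
import Literature.RingTheory.MvPolynomial.LexFirstVariable

/-!
# Coefficients of the cobordant chart `x ↦ s^{w}(c + y)` and the singular-successor criterion

Folklore infrastructure for the local weighted resolution game (route
ResolutionOfSingularities/WeightedInvariant, crux `LocalWeightedDrop`, item
stmt-ResolutionOfSingularities-8899).  For weights `w : Fin n → ℕ` and an exceptional point
`c : Fin n → k` of Włodarczyk's full cobordant blow-up (`c_i = 0` whenever `w_i = 0` — the crux's
convention, hypothesis `hc` below), the chart is the substitution
`chart w c : x_i ↦ s^{w_i} (c_i + y_i)` (`s = X 0`, `y_i = X i.succ`; `cruxChart_eq_chart`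
identifies it with the literal family in the crux).  Everything over a field `k`:

* `coeff_prod_C_add_X_pow` — Taylor coefficients `coeff β ∏ᵢ (cᵢ + Xᵢ)^{dᵢ} = ∏ᵢ C(dᵢ,βᵢ) cᵢ^{dᵢ-βᵢ}`;
* `coeff_subst_chart` — THE COEFFICIENT FORMULA
  `coeff (b, β) f(s^w(c+y)) = ∑_{w·d = b} f_d ∏ᵢ C(dᵢ, βᵢ) cᵢ^{dᵢ - βᵢ}`;
* `coeff_subst_chart_eq_zero_of_lt`, `exists_coeff_subst_chart_ne_zero`, `subst_chart_ne_zero`,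
  `eq_weightedOrder_of_factor` — the `s`-order of the transform is the `w`-ORDER of `f`, for every
  `c` (so the chart kills no non-zero series, and in the crux's factorisation `f(s^w(c+y)) = sᵃ g`,
  `s ∤ g`, the exponent `a` is `weightedOrder w f`);
* `initEval w c b f = P_b(c)` (weight-`b` part of `f` evaluated at `c`), `initEvalD` (`∂ᵢP_b(c)`),
  and `successor_singular_iff` — the `s`-saturated transform `g` is SINGULAR at `c`
  (`g(0) = 0`, no linear terms) iff `P_a(c) = 0 ∧ ∀ i, ∂ᵢP_a(c) = 0 ∧ P_{a+1}(c) = 0`.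

This is the computation behind every example in the subject (Hauser's kangaroo points,
Hauser–Perlega cycles, Abramovich–Quek–Schober's plane-curve charts, Def. 6.1 of
arXiv:2412.16426); recorded here once, for formal power series and arbitrary weights/points.
-/

namespace Literature.AlgebraicGeometry.Resolution.CobordantChart

open MvPolynomial Literature.RingTheory.MvPolynomial

variable {k : Type*} [Field k] {n : ℕ}

open MvPolynomial


/-- Taylor coefficients of a product of translated powers:
`coeff β (∏ i, (C cᵢ + Xᵢ)^{dᵢ}) = ∏ i, C(dᵢ, βᵢ) cᵢ^{dᵢ - βᵢ}`. [folklore] -/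
theorem coeff_prod_C_add_X_pow (c : Fin n → k) (d : Fin n → ℕ) (β : Fin n →₀ ℕ) :
    MvPolynomial.coeff β (∏ i, (C (c i) + X i : MvPolynomial (Fin n) k) ^ (d i)) =
      ∏ i, (((d i).choose (β i) : k) * c i ^ (d i - β i)) := by
  classical
  have hfac : ∀ i, (C (c i) + X i : MvPolynomial (Fin n) k) ^ (d i) =
      ∑ l ∈ Finset.range (d i + 1), C (((d i).choose l : k) * c i ^ (d i - l)) * X i ^ l := by
    intro i
    rw [add_comm, add_pow]
    refine Finset.sum_congr rfl fun l _ => ?_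
    simp only [map_mul, map_natCast, map_pow]
    ring
  simp_rw [hfac]
  rw [Finset.prod_univ_sum, MvPolynomial.coeff_sum]
  have hterm : ∀ L : Fin n → ℕ,
      (∏ i, C (((d i).choose (L i) : k) * c i ^ (d i - L i)) * X i ^ (L i) : MvPolynomial (Fin n) k) =
        monomial (Finsupp.equivFunOnFinite.symm L) (∏ i, (((d i).choose (L i) : k) * c i ^ (d i - L i))) := by
    intro L
    rw [Finset.prod_mul_distrib, ← map_prod, MvPolynomial.monomial_eq, Finsupp.prod_pow]
    simp
  simp_rw [hterm, MvPolynomial.coeff_monomial]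
  rw [Finset.sum_eq_single (⇑β)]
  · simp
  · intro L _ hL
    rw [if_neg]
    intro h
    apply hL
    rw [← h]
    simp
  · intro hβ
    rw [if_pos (by simp)]
    rw [Fintype.mem_piFinset] at hβ
    push Not at hβ
    obtain ⟨i, hi⟩ := hβ
    rw [Finset.mem_range, not_lt] at hi
    apply Finset.prod_eq_zero (Finset.mem_univ i)
    rw [Nat.choose_eq_zero_of_lt (by omega), Nat.cast_zero, zero_mul]

/-- The general cobordant chart at the exceptional point `c` (polynomial form):
`x_i ↦ s^{w_i} (c_i + y_i)` with `s = X 0`, `y_i = X i.succ`. (For the crux take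
`c_i := 0` whenever `w_i = 0`.) [folklore] -/
noncomputable def chartPoly (w : Fin n → ℕ) (c : Fin n → k) (i : Fin n) : MvPolynomial (Fin (n + 1)) k :=
  X 0 ^ (w i) * (C (c i) + X i.succ)

/-- Power-series form of the chart. [folklore] -/
noncomputable def chart (w : Fin n → ℕ) (c : Fin n → k) (i : Fin n) : MvPowerSeries (Fin (n + 1)) k :=
  ↑(chartPoly w c i)

/-- `chart_apply` (see the module docstring). [folklore] -/
theorem chart_apply (w : Fin n → ℕ) (c : Fin n → k) (i : Fin n) :
    chart w c i = MvPowerSeries.X 0 ^ (w i) * (MvPowerSeries.C (c i) + MvPowerSeries.X i.succ) := by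
  simp [chart, chartPoly, MvPolynomial.coe_mul, MvPolynomial.coe_pow, MvPolynomial.coe_X,
    MvPolynomial.coe_add, MvPolynomial.coe_C]

/-- The crux's chart family equals `chart w c'` with `c'_i = c_i` for `w_i > 0` and `0` otherwise. [folklore] -/
theorem cruxChart_eq_chart (w : Fin n → ℕ) (c : Fin n → k) :
    (fun i : Fin n => if 0 < w i then
        MvPowerSeries.X (0 : Fin (n + 1)) ^ (w i) * (MvPowerSeries.C (c i) + MvPowerSeries.X i.succ)
      else (MvPowerSeries.X i.succ : MvPowerSeries (Fin (n + 1)) k)) =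
      chart w (fun i => if 0 < w i then c i else 0) := by
  funext i
  rw [chart_apply]
  by_cases h : 0 < w i
  · simp [h]
  · have h0 : w i = 0 := by omega
    simp [h0]

/-- The chart is substitutable as soon as `c_i = 0` whenever `w_i = 0` (the crux's convention). [folklore] -/
theorem hasSubst_chart (w : Fin n → ℕ) (c : Fin n → k) (hc : ∀ i, w i = 0 → c i = 0) :
    MvPowerSeries.HasSubst (chart w c) :=
  MvPowerSeries.hasSubst_of_constantCoeff_zero fun i => by
    rw [chart_apply]
    by_cases h : w i = 0
    · simp [h, hc i h, MvPowerSeries.constantCoeff_X]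
    · simp [MvPowerSeries.constantCoeff_X, zero_pow h]

/-- Coefficients of a polynomial renamed along `Fin.succ`. [folklore] -/
theorem coeff_cons_rename_succ (r : ℕ) (β : Fin n →₀ ℕ) (S : MvPolynomial (Fin n) k) :
    MvPolynomial.coeff (Finsupp.cons r β) (rename Fin.succ S) = if r = 0 then MvPolynomial.coeff β S else 0 := by
  split_ifs with hr
  · subst hr
    rw [← mapDomain_succ_eq_cons, coeff_rename_mapDomain _ (Fin.succ_injective n)]
  · apply coeff_rename_eq_zero
    intro u hu
    exfalso
    apply hr
    have := congrArg (fun e => e 0) hu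
    simp only [mapDomain_succ_eq_cons, Finsupp.cons_zero] at this
    exact this.symm

/-- The chart image of the monomial `x^d`: `∏ i, (chartPoly i)^{d i} = X 0 ^ (w·d) * rename succ (∏ (C c_i + X_i)^{d_i})`. [folklore] -/
theorem prod_chartPoly_pow (w : Fin n → ℕ) (c : Fin n → k) (d : Fin n →₀ ℕ) :
    (d.prod fun i m => chartPoly w c i ^ m) =
      X 0 ^ (Finsupp.weight w d) * rename Fin.succ (∏ i, (C (c i) + X i : MvPolynomial (Fin n) k) ^ (d i)) := by
  rw [Finsupp.prod_pow, map_prod]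
  simp only [chartPoly, mul_pow, ← pow_mul, Finset.prod_mul_distrib, Finset.prod_pow_eq_pow_sum,
    map_pow, map_add, rename_C, rename_X]
  congr 2
  rw [Finsupp.weight_apply, Finsupp.sum_fintype]
  · exact Finset.sum_congr rfl fun i _ => by rw [smul_eq_mul, mul_comm]
  · intro i; simp

/-- COEFFICIENT FORMULA for the general cobordant chart: the coefficient of `s^b y^β` in
`f(s^{w}(c + y))` is `∑_{d : w·d = b} f_d ∏ᵢ C(dᵢ, βᵢ) cᵢ^{dᵢ-βᵢ}` (a finitely supported sum;
with `cᵢ = 0` the factor forces `dᵢ = βᵢ`). [folklore] -/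
theorem coeff_subst_chart (w : Fin n → ℕ) (c : Fin n → k) (hc : ∀ i, w i = 0 → c i = 0)
    (f : MvPowerSeries (Fin n) k) (b : ℕ) (β : Fin n →₀ ℕ) :
    MvPowerSeries.coeff (Finsupp.cons b β) (MvPowerSeries.subst (chart w c) f) =
      ∑ᶠ d : Fin n →₀ ℕ, if Finsupp.weight w d = b then
        MvPowerSeries.coeff d f * ∏ i, (((d i).choose (β i) : k) * c i ^ (d i - β i)) else 0 := by
  classical
  rw [MvPowerSeries.coeff_subst (hasSubst_chart w c hc)]
  refine finsum_congr fun d => ?_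
  have hprod : (d.prod fun i m => chart w c i ^ m) =
      ((d.prod fun i m => chartPoly w c i ^ m : MvPolynomial (Fin (n + 1)) k) :
        MvPowerSeries (Fin (n + 1)) k) := by
    simp only [Finsupp.prod]
    rw [← MvPolynomial.coeToMvPowerSeries.ringHom_apply, map_prod]
    simp only [map_pow, MvPolynomial.coeToMvPowerSeries.ringHom_apply, chart]
  have hsub : Finsupp.cons b β - Finsupp.single (0 : Fin (n + 1)) (Finsupp.weight w d) =
      Finsupp.cons (b - Finsupp.weight w d) β := by
    ext j
    refine Fin.cases ?_ (fun i => ?_) j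
    · simp
    · simp [Finsupp.cons_succ, Fin.succ_ne_zero]
  rw [hprod, MvPolynomial.coeff_coe, prod_chartPoly_pow, MvPolynomial.X_pow_eq_monomial,
    MvPolynomial.coeff_monomial_mul']
  have hcoeff := coeff_prod_C_add_X_pow c (⇑d) β
  by_cases hle : Finsupp.single (0 : Fin (n + 1)) (Finsupp.weight w d) ≤ Finsupp.cons b β
  · rw [if_pos hle, hsub, coeff_cons_rename_succ, smul_eq_mul, one_mul]
    have hle' : Finsupp.weight w d ≤ b := by
      have := (Finsupp.single_le_iff).mp hle
      simpa using this
    by_cases hb : Finsupp.weight w d = b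
    · subst hb
      simp [hcoeff]
    · have hne : b - Finsupp.weight w d ≠ 0 := by omega
      simp [hne, hb]
  · rw [if_neg hle, smul_zero]
    have hne : Finsupp.weight w d ≠ b := by
      intro hb
      apply hle
      rw [Finsupp.single_le_iff, Finsupp.cons_zero, hb]
    rw [if_neg hne]


/-! ### The `s`-order of the transform equals the `w`-order of `f` -/

/-- Below the `w`-order of `f` every coefficient of the transform vanishes. [folklore] -/
theorem coeff_subst_chart_eq_zero_of_lt (w : Fin n → ℕ) (c : Fin n → k) (hc : ∀ i, w i = 0 → c i = 0)
    (f : MvPowerSeries (Fin n) k) {b : ℕ} (hb : (b : ℕ∞) < f.weightedOrder w) (β : Fin n →₀ ℕ) :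
    MvPowerSeries.coeff (Finsupp.cons b β) (MvPowerSeries.subst (chart w c) f) = 0 := by
  rw [coeff_subst_chart w c hc]
  apply finsum_eq_zero_of_forall_eq_zero
  intro d
  split_ifs with hd
  · rw [MvPowerSeries.coeff_eq_zero_of_lt_weightedOrder w (by rw [hd]; exact hb), zero_mul]
  · rfl

/-- At the `w`-order `ν` of `f ≠ 0` some coefficient `s^ν y^β` of the transform is non-zero
(take `β` maximal among the weight-`ν` exponents of `f` agreeing with a fixed one off the support
of `c`). Hence the general chart kills no non-zero series. [folklore] -/
theorem exists_coeff_subst_chart_ne_zero (w : Fin n → ℕ) (c : Fin n → k)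
    (hc : ∀ i, w i = 0 → c i = 0) {f : MvPowerSeries (Fin n) k} (hf : f ≠ 0) :
    ∃ β : Fin n →₀ ℕ, MvPowerSeries.coeff β f ≠ 0 ∧ (Finsupp.weight w β : ℕ∞) = f.weightedOrder w ∧
      MvPowerSeries.coeff (Finsupp.cons (Finsupp.weight w β) β) (MvPowerSeries.subst (chart w c) f) =
        MvPowerSeries.coeff β f := by
  classical
  obtain ⟨d₀, hd₀, hν⟩ := MvPowerSeries.exists_coeff_ne_zero_and_weightedOrder w
    ((MvPowerSeries.ne_zero_iff_weightedOrder_finite w).mp hf)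
  set ν := Finsupp.weight w d₀ with hνdef
  -- the finite class of weight-ν exponents in the support agreeing with d₀ off supp c
  let bound : Fin n →₀ ℕ := Finsupp.equivFunOnFinite.symm fun j => if c j = 0 then d₀ j else ν
  let T : Finset (Fin n →₀ ℕ) := (Finset.Iic bound).filter fun d =>
    MvPowerSeries.coeff d f ≠ 0 ∧ Finsupp.weight w d = ν ∧ ∀ j, c j = 0 → d j = d₀ j
  have hwle : ∀ d : Fin n →₀ ℕ, Finsupp.weight w d = ν → ∀ j, c j ≠ 0 → d j ≤ ν := by
    intro d hd j hj
    have hwj : 0 < w j := by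
      by_contra h0
      exact hj (hc j (by omega))
    calc d j ≤ d j * w j := Nat.le_mul_of_pos_right _ hwj
      _ ≤ Finsupp.weight w d := by
          rw [Finsupp.weight_apply, Finsupp.sum_fintype _ _ (fun i => by simp)]
          exact Finset.single_le_sum (f := fun i => d i • w i) (fun i _ => Nat.zero_le _)
            (Finset.mem_univ j)
      _ = ν := hd
  have hmemT : ∀ d : Fin n →₀ ℕ, d ∈ T ↔
      (MvPowerSeries.coeff d f ≠ 0 ∧ Finsupp.weight w d = ν ∧ ∀ j, c j = 0 → d j = d₀ j) := by
    intro d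
    simp only [T, Finset.mem_filter, Finset.mem_Iic, and_iff_right_iff_imp]
    rintro ⟨-, hwd, hoff⟩ j
    show d j ≤ bound j
    simp only [bound, Finsupp.coe_equivFunOnFinite_symm]
    by_cases hj : c j = 0
    · simp [hj, hoff j hj]
    · simp [hj, hwle d hwd j hj]
  have hd₀T : d₀ ∈ T := (hmemT d₀).mpr ⟨hd₀, rfl, fun _ _ => rfl⟩
  obtain ⟨β, hβT, hmax⟩ := T.exists_maximal ⟨d₀, hd₀T⟩
  obtain ⟨hβf, hβw, hβoff⟩ := (hmemT β).mp hβT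
  refine ⟨β, hβf, by rw [hβw, hνdef, hν], ?_⟩
  rw [coeff_subst_chart w c hc, finsum_eq_single _ β]
  · simp [hβw]
  · intro d hdβ
    split_ifs with hwd
    · -- some factor of the product vanishes
      by_cases hfd : MvPowerSeries.coeff d f = 0
      · rw [hfd, zero_mul]
      suffices h : ∃ j, ((d j).choose (β j) : k) * c j ^ (d j - β j) = 0 by
        obtain ⟨j, hj⟩ := h
        rw [Finset.prod_eq_zero (Finset.mem_univ j) hj, mul_zero]
      by_contra hall
      push Not at hall
      have hfac : ∀ j, β j ≤ d j ∧ (c j = 0 → d j = β j) := by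
        intro j
        have h := hall j
        refine ⟨?_, fun hcj => ?_⟩
        · by_contra hlt
          exact h (by rw [Nat.choose_eq_zero_of_lt (by omega), Nat.cast_zero, zero_mul])
        · by_contra hne
          have hlt : β j < d j := lt_of_le_of_ne (by
            by_contra hlt
            exact h (by rw [Nat.choose_eq_zero_of_lt (by omega), Nat.cast_zero, zero_mul])) (Ne.symm hne)
          exact h (by rw [hcj, zero_pow (by omega), mul_zero])
      have hdT : d ∈ T := (hmemT d).mpr ⟨hfd, by rw [hwd, hβw], fun j hj => by
        rw [(hfac j).2 hj, hβoff j hj]⟩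
      have hle : β ≤ d := fun j => (hfac j).1
      exact hdβ (le_antisymm (hmax hdT hle) hle)
    · rfl

/-- `subst_chart_ne_zero` (see the module docstring). [folklore] -/
theorem subst_chart_ne_zero (w : Fin n → ℕ) (c : Fin n → k) (hc : ∀ i, w i = 0 → c i = 0)
    {f : MvPowerSeries (Fin n) k} (hf : f ≠ 0) : MvPowerSeries.subst (chart w c) f ≠ 0 := by
  obtain ⟨β, hβf, -, hcoeff⟩ := exists_coeff_subst_chart_ne_zero w c hc hf
  intro h
  rw [h, map_zero] at hcoeff
  exact hβf hcoeff.symm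

/-- Coefficients of the `s`-saturation `g` of `F' = sᵃ·g`. [folklore] -/
theorem coeff_cons_of_eq_X_pow_mul {F g : MvPowerSeries (Fin (n + 1)) k} {a : ℕ}
    (h : F = MvPowerSeries.X 0 ^ a * g) (r : ℕ) (β : Fin n →₀ ℕ) :
    MvPowerSeries.coeff (Finsupp.cons r β) g = MvPowerSeries.coeff (Finsupp.cons (a + r) β) F := by
  have hadd : Finsupp.cons (a + r) β = Finsupp.cons r β + Finsupp.single (0 : Fin (n + 1)) a := by
    ext j
    refine Fin.cases ?_ (fun i => ?_) j
    · simp [add_comm]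
    · simp [Finsupp.cons_succ, Fin.succ_ne_zero]
  rw [h, hadd, MvPowerSeries.X_pow_eq, MvPowerSeries.coeff_monomial_mul]
  simp

/-- In the crux's factorisation `f(s^w(c+y)) = sᵃ · g`, `s ∤ g`, the exponent `a` IS the
`w`-order of `f`. [folklore] -/
theorem eq_weightedOrder_of_factor (w : Fin n → ℕ) (c : Fin n → k) (hc : ∀ i, w i = 0 → c i = 0)
    {f : MvPowerSeries (Fin n) k} (hf : f ≠ 0) {a : ℕ} {g : MvPowerSeries (Fin (n + 1)) k}
    (hfac : MvPowerSeries.subst (chart w c) f = MvPowerSeries.X 0 ^ a * g)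
    (hg : ¬ MvPowerSeries.X 0 ∣ g) : (a : ℕ∞) = f.weightedOrder w := by
  obtain ⟨β, hβf, hβw, hcoeff⟩ := exists_coeff_subst_chart_ne_zero w c hc hf
  apply le_antisymm
  · -- `a ≤ ν`: the coefficient `s^ν y^β ≠ 0` of `sᵃ g` forces `a ≤ ν`
    rw [← hβw]
    by_contra hlt
    push Not at hlt
    have hlt' : Finsupp.weight w β < a := by exact_mod_cast hlt
    have : MvPowerSeries.coeff (Finsupp.cons (Finsupp.weight w β) β)
        (MvPowerSeries.X (0 : Fin (n + 1)) ^ a * g) = 0 := by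
      rw [MvPowerSeries.X_pow_eq, MvPowerSeries.coeff_monomial_mul, if_neg]
      rw [Finsupp.single_le_iff, Finsupp.cons_zero]
      omega
    rw [← hfac, hcoeff] at this
    exact hβf this
  · -- `ν ≤ a`: `s ∤ g` gives a coefficient `s⁰ y^γ ≠ 0` of `g`, i.e. `sᵃ y^γ ≠ 0` of `F'`
    rw [MvPowerSeries.X_dvd_iff] at hg
    push Not at hg
    obtain ⟨m, hm0, hm⟩ := hg
    have hm' : m = Finsupp.cons 0 (Finsupp.tail m) := by
      rw [← Finsupp.cons_tail m, hm0]; simp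
    rw [hm', coeff_cons_of_eq_X_pow_mul hfac, add_zero] at hm
    by_contra hlt
    push Not at hlt
    exact hm (coeff_subst_chart_eq_zero_of_lt w c hc f hlt _)


/-! ### The singular-successor criterion -/

/-- `P_b(c)`: the `w`-weight-`b` part of `f` evaluated at `c` (a finitely supported sum; with the
crux's convention `c_j = 0` for `w_j = 0` only exponents with `d_j = 0` there contribute). [folklore] -/
noncomputable def initEval (w : Fin n → ℕ) (c : Fin n → k) (b : ℕ) (f : MvPowerSeries (Fin n) k) : k :=
  ∑ᶠ d : Fin n →₀ ℕ, if Finsupp.weight w d = b then MvPowerSeries.coeff d f * ∏ i, c i ^ (d i) else 0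

/-- `∂P_b/∂x_i (c)`: the formal partial derivative of the weight-`b` part of `f`, evaluated at `c`. [folklore] -/
noncomputable def initEvalD (w : Fin n → ℕ) (c : Fin n → k) (b : ℕ) (f : MvPowerSeries (Fin n) k)
    (i : Fin n) : k :=
  ∑ᶠ d : Fin n →₀ ℕ, if Finsupp.weight w d = b then
    MvPowerSeries.coeff d f * (((d i : ℕ) : k) * c i ^ (d i - 1) * ∏ j ∈ Finset.univ.erase i, c j ^ (d j))
    else 0

/-- `coeff_cons_zero_subst_chart` (see the module docstring). [folklore] -/
theorem coeff_cons_zero_subst_chart (w : Fin n → ℕ) (c : Fin n → k) (hc : ∀ i, w i = 0 → c i = 0)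
    (f : MvPowerSeries (Fin n) k) (b : ℕ) :
    MvPowerSeries.coeff (Finsupp.cons b 0) (MvPowerSeries.subst (chart w c) f) = initEval w c b f := by
  rw [coeff_subst_chart w c hc, initEval]
  refine finsum_congr fun d => ?_
  simp

/-- `coeff_cons_single_subst_chart` (see the module docstring). [folklore] -/
theorem coeff_cons_single_subst_chart (w : Fin n → ℕ) (c : Fin n → k)
    (hc : ∀ i, w i = 0 → c i = 0) (f : MvPowerSeries (Fin n) k) (b : ℕ) (i : Fin n) :
    MvPowerSeries.coeff (Finsupp.cons b (Finsupp.single i 1)) (MvPowerSeries.subst (chart w c) f) =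
      initEvalD w c b f i := by
  classical
  rw [coeff_subst_chart w c hc, initEvalD]
  refine finsum_congr fun d => ?_
  split_ifs with hd
  · congr 1
    rw [← Finset.mul_prod_erase Finset.univ _ (Finset.mem_univ i)]
    congr 1
    · simp
    · refine Finset.prod_congr rfl fun j hj => ?_
      have hji : j ≠ i := (Finset.mem_erase.mp hj).1
      simp [Ne.symm hji]
  · rfl

/-- SINGULAR-SUCCESSOR CRITERION.  Let `f ≠ 0` and let `f(s^w(c+y)) = sᵃ·g` with `s ∤ g` be the
crux's factorisation at the exceptional point `c` (so `a` is the `w`-order of `f`,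
`eq_weightedOrder_of_factor`).  Then `g` is singular at the point (`g ∈ 𝔪²`) iff
`P_a(c) = 0`, `∂P_a/∂xᵢ(c) = 0` for all `i`, and `P_{a+1}(c) = 0`. [folklore] -/
theorem successor_singular_iff (w : Fin n → ℕ) (c : Fin n → k) (hc : ∀ i, w i = 0 → c i = 0)
    (f : MvPowerSeries (Fin n) k) {a : ℕ} {g : MvPowerSeries (Fin (n + 1)) k}
    (hfac : MvPowerSeries.subst (chart w c) f = MvPowerSeries.X 0 ^ a * g) :
    (MvPowerSeries.constantCoeff g = 0 ∧ ∀ j, MvPowerSeries.coeff (Finsupp.single j 1) g = 0) ↔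
      (initEval w c a f = 0 ∧ (∀ i, initEvalD w c a f i = 0) ∧ initEval w c (a + 1) f = 0) := by
  have h0 : MvPowerSeries.constantCoeff g = initEval w c a f := by
    rw [← MvPowerSeries.coeff_zero_eq_constantCoeff_apply, ← Finsupp.cons_zero_zero,
      coeff_cons_of_eq_X_pow_mul hfac, add_zero, coeff_cons_zero_subst_chart w c hc]
  have hs : MvPowerSeries.coeff (Finsupp.single (0 : Fin (n + 1)) 1) g = initEval w c (a + 1) f := by
    rw [← Finsupp.cons_zero_eq_single_zero, coeff_cons_of_eq_X_pow_mul hfac,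
      coeff_cons_zero_subst_chart w c hc]
  have hy : ∀ i : Fin n, MvPowerSeries.coeff (Finsupp.single i.succ 1) g = initEvalD w c a f i := by
    intro i
    rw [← Finsupp.cons_zero_single_eq_single_succ, coeff_cons_of_eq_X_pow_mul hfac, add_zero,
      coeff_cons_single_subst_chart w c hc]
  constructor
  · rintro ⟨hg0, hg1⟩
    refine ⟨h0 ▸ hg0, fun i => (hy i) ▸ hg1 i.succ, hs ▸ hg1 0⟩
  · rintro ⟨hP, hD, hP1⟩
    refine ⟨h0 ▸ hP, fun j => ?_⟩
    refine Fin.cases ?_ (fun i => ?_) j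
    · rw [hs, hP1]
    · rw [hy, hD]


end Literature.AlgebraicGeometry.Resolution.CobordantChart
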